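import Mathlib.Analysis.InnerProductSpace.Basic
import HarnessLib

/-!
# Soundness lemmas (L1), (L2) for the loose-capacity certificate checker `capcc` (crux `CoaxialWallLaw`, stmt-Ventures-19481)

HONEST FRAMING. Venture `Summits/Ventures/Crystal3D` (cell `crystal3d-full`); helper `--supports` the crux `CoaxialWallLaw`
(stmt-Ventures-19481, `route-Ventures-StickyWulffConstant`), registered line 'CoaxialWallLawCertificates' (planner cf-p1, stub
`stub_lensCert`).  cf-p1 DECISION (cxliii)(3)/(2): the capacity table of cf-p2's PREREG (69.0⁶) is certified by DATA (rational caps,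
pins, quadtree cell lists — cf-p2's `capcc.py` / `capcc_check.py`, decider family 'clique-cover') checked by a verified checker; the
checker needs four spherical-geometry lemmas ONCE ((L1) cap, (L2) cell-in-cap, (L3) pin, (L4) cross-cell; cf-p2 INBOX
2026-08-29T07:50:59Z).  This file proves (L1) and (L2); the companion '…CapCheckerCoverLemmas' proves (L3), (L4) and the cover ⇒ capacity
bookkeeping.  Everything is over an arbitrary real inner-product space `V` (the lemmas are dimension-free) and in exactly the arithmetic
shape the checker evaluates (squared rational tests, no square roots, no angles).

SETTING (PREREG (69.0⁶)(b)(c)).  A pool member `y` with blockers `w = q − y` (`q` exact, `‖w‖ < 2`); a loose ball at `y + u`, `‖u‖ = 1`, is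
admissible iff `‖u − w‖ ≥ 1` for every blocker, i.e. `⟪u, w⟫ ≤ ‖w‖²/2` («free»); witnesses of one member are pairwise `≥ 1` apart
(chord `‖u − u'‖ ≥ 1 ⇔ ⟪u, u'⟫ ≤ ½`).  A certificate for `cap(y) ≤ k` lists `k` closed caps `{u : ⟪u, c_j⟫ ≥ g_j}` with `g_j > 0`,
`4 g_j² > 3 ‖c_j‖²`, pin caps, and a quadtree of planar cells (corner vectors `p_i`; the cell's directions are `v/‖v‖`, `v ∈ conv{p_i}`)
each certified inside an open blocker cap, an open pin cap, or a closed cover cap.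
* `norm_sub_sq_of_unit`, `norm_sub_lt_one_iff`, `one_le_norm_sub_iff` — chord versus inner product for unit vectors;
  `ne_zero_of_inner_pos`.  (The unit-norm of `‖v‖⁻¹ • v` is `Literature.Analysis.Potential.SphereMoebius.norm_normalize`; inlined here.)
* **(L1)** `smallCap_arith` (real core), **`inner_gt_half_of_mem_smallCap`** — `‖u‖ = ‖v‖ = 1`, `0 < g`, `3‖c‖² < 4g²`, `g ≤ ⟪u, c⟫`,
  `g ≤ ⟪v, c⟫ ⇒ ½ < ⟪u, v⟫` (the cap has angular radius `< 30°`); `norm_sub_lt_one_of_mem_smallCap` (chord `< 1`);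
  `smallCap_subsingleton` / `card_filter_smallCap_le_one` — such a cap holds at most ONE member of a `1`-separated family.
* **(L2) cell-in-cap** (`capcc.cell_in_cap(corners, c, g, strict)`): `le_inner_sum_smul` / `lt_inner_sum_smul` (an affine lower bound
  `m ≤ ⟪p_i, c⟫` at the corners passes to convex combinations), `norm_sum_smul_le` / `norm_sq_sum_smul_le` (so does a norm bound),
  `mul_norm_le_inner_of_sq_test` / `mul_norm_lt_inner_of_sq_test` (`0 < m ≤ ⟪v, c⟫`, `‖v‖² ≤ M`, `g²M ≤ m²` (resp. `<`) ⇒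
  `g‖v‖ ≤ ⟪v, c⟫` (resp. `<`), for ANY sign of `g` — pin thresholds may be negative), assembled as **`cellInCap_le`** (closed cover caps)
  / **`cellInCap_lt`** (open blocker and pin caps) and the normalised readings `le_inner_normalize(_of_cellInCap)` /
  `lt_inner_normalize(_of_cellInCap)` (`g ≤ ⟪v/‖v‖, c⟫`, resp. `<`).
Proofs: (L1) by the scaled projections `‖c‖²u − ⟪u, c⟫c` and Cauchy–Schwarz, reduced to the real-arithmetic core (no division);
(L2) by `sum_inner`, `norm_sum_le`, `sq_le_sq₀`.
WHAT THIS IS NOT: not the checker (`check : Cert → Bool` + `check_sound` come after cf-p2 fixes the certificate schema, PREREG (69.0⁶)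
addendum); not the chart bookkeeping (cube-face charts cover `S²`; a rectangle point is a bilinear convex combination of its corners —
coordinate facts that belong with the data types); no statement about types, tables or packings; F-C1 not moved.
-/

namespace Summit.Ventures.Crystal3D.Theorems

namespace CapChecker

open Finset
open scoped InnerProductSpace

variable {V : Type*} [NormedAddCommGroup V] [InnerProductSpace ℝ V]

/-! ### Chord versus inner product -/

/-- For unit vectors, `‖u − v‖² = 2 − 2⟪u, v⟫`. -/
theorem norm_sub_sq_of_unit {u v : V} (hu : ‖u‖ = 1) (hv : ‖v‖ = 1) :
    ‖u - v‖ ^ 2 = 2 - 2 * ⟪u, v⟫_ℝ := by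
  rw [norm_sub_sq_real, hu, hv]; ring

/-- For unit vectors, chord `< 1` iff inner product `> ½` (angle `< 60°`). -/
theorem norm_sub_lt_one_iff {u v : V} (hu : ‖u‖ = 1) (hv : ‖v‖ = 1) :
    ‖u - v‖ < 1 ↔ 1 / 2 < ⟪u, v⟫_ℝ := by
  rw [← sq_lt_sq₀ (norm_nonneg _) zero_le_one, one_pow, norm_sub_sq_of_unit hu hv]
  constructor <;> intro h <;> linarith

/-- For unit vectors, chord `≥ 1` iff inner product `≤ ½` (angle `≥ 60°`): the separation condition of two witnesses. -/
theorem one_le_norm_sub_iff {u v : V} (hu : ‖u‖ = 1) (hv : ‖v‖ = 1) :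
    1 ≤ ‖u - v‖ ↔ ⟪u, v⟫_ℝ ≤ 1 / 2 := by
  rw [← sq_le_sq₀ zero_le_one (norm_nonneg _), one_pow, norm_sub_sq_of_unit hu hv]
  constructor <;> intro h <;> linarith

/-- A vector with a positive inner product against something is nonzero. -/
theorem ne_zero_of_inner_pos {v c : V} (h : 0 < ⟪v, c⟫_ℝ) : v ≠ 0 := by
  rintro rfl
  rw [inner_zero_left] at h
  exact lt_irrefl 0 h

/-! ### (L1) A cap of angular radius `< 30°` holds at most one witness -/

/-- **(L1), real-arithmetic core.**  With `N = ‖c‖²`, `p = ⟪u, c⟫`, `q = ⟪v, c⟫`, `PU = ‖N u − p c‖`, `PW = ‖N v − q c‖`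
(`PU² = N(N − p²)`, `PW² = N(N − q²)`) and `X = ⟪N u − p c, N v − q c⟫ = N²⟪u, v⟫ − N p q ≥ −PU·PW` (Cauchy–Schwarz): if `0 < g ≤ p, q`
and `3N < 4g²` then `⟪u, v⟫ > ½` — because `p², q², pq > ¾N` give `PU·PW < N²/4` and `N p q > ¾N²`. -/
theorem smallCap_arith {N p q g ip X PU PW : ℝ} (hg : 0 < g) (hcap : 3 * N < 4 * g ^ 2) (hp : g ≤ p) (hq : g ≤ q)
    (hpN : p ^ 2 ≤ N) (hqN : q ^ 2 ≤ N) (hPU : PU ^ 2 = N * (N - p ^ 2)) (hPW : PW ^ 2 = N * (N - q ^ 2))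
    (hPU0 : 0 ≤ PU) (hPW0 : 0 ≤ PW) (hCS : -(PU * PW) ≤ X) (hX : X = N ^ 2 * ip - N * p * q) : 1 / 2 < ip := by
  have hgp : g ^ 2 ≤ p ^ 2 := pow_le_pow_left₀ hg.le hp 2
  have hgq : g ^ 2 ≤ q ^ 2 := pow_le_pow_left₀ hg.le hq 2
  have hN : 0 < N := lt_of_lt_of_le (pow_pos hg 2) (hgp.trans hpN)
  have hp2 : N - p ^ 2 < N / 4 := by linarith
  have hq2 : N - q ^ 2 < N / 4 := by linarith
  have hpq : 3 / 4 * N < p * q := by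
    have h1 : g * g ≤ p * q := mul_le_mul hp hq hg.le (hg.le.trans hp)
    have h2 : g ^ 2 = g * g := sq g
    linarith
  have h2 : (N - p ^ 2) * (N - q ^ 2) < N / 4 * (N / 4) :=
    mul_lt_mul'' hp2 hq2 (sub_nonneg.2 hpN) (sub_nonneg.2 hqN)
  have hprod : PU * PW < N ^ 2 / 4 := by
    have h1 : (PU * PW) ^ 2 < (N ^ 2 / 4) ^ 2 := by
      have h3 := mul_lt_mul_of_pos_left h2 (pow_pos hN 2)
      calc (PU * PW) ^ 2 = N ^ 2 * ((N - p ^ 2) * (N - q ^ 2)) := by rw [mul_pow, hPU, hPW]; ring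
        _ < N ^ 2 * (N / 4 * (N / 4)) := h3
        _ = (N ^ 2 / 4) ^ 2 := by ring
    exact (sq_lt_sq₀ (mul_nonneg hPU0 hPW0) (by positivity)).1 h1
  have h4 := mul_lt_mul_of_pos_left hpq hN
  have hfin : N ^ 2 * (1 / 2) < N ^ 2 * ip := by nlinarith
  exact lt_of_mul_lt_mul_left hfin (pow_pos hN 2).le

/-- **(L1), inner-product form.**  Two unit vectors in the closed cap `{x : g ≤ ⟪x, c⟫}` with `0 < g` and `3‖c‖² < 4g²` (angular
radius `< 30°`) satisfy `½ < ⟪u, v⟫` (angle `< 60°`).  Proof without division: the scaled projections `‖c‖²u − ⟪u, c⟫c`,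
`‖c‖²v − ⟪v, c⟫c` and Cauchy–Schwarz (`smallCap_arith`). -/
theorem inner_gt_half_of_mem_smallCap {u v c : V} {g : ℝ} (hu : ‖u‖ = 1) (hv : ‖v‖ = 1) (hg : 0 < g)
    (hcap : 3 * ‖c‖ ^ 2 < 4 * g ^ 2) (huc : g ≤ ⟪u, c⟫_ℝ) (hvc : g ≤ ⟪v, c⟫_ℝ) : 1 / 2 < ⟪u, v⟫_ℝ := by
  have hpc : ⟪u, c⟫_ℝ ≤ ‖c‖ := by
    have h := real_inner_le_norm u c
    rwa [hu, one_mul] at h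
  have hqc : ⟪v, c⟫_ℝ ≤ ‖c‖ := by
    have h := real_inner_le_norm v c
    rwa [hv, one_mul] at h
  have hcc : ⟪c, c⟫_ℝ = ‖c‖ ^ 2 := real_inner_self_eq_norm_sq c
  have huu : ⟪u, u⟫_ℝ = 1 := by rw [real_inner_self_eq_norm_sq, hu, one_pow]
  have hvv : ⟪v, v⟫_ℝ = 1 := by rw [real_inner_self_eq_norm_sq, hv, one_pow]
  have hcu : ⟪c, u⟫_ℝ = ⟪u, c⟫_ℝ := real_inner_comm u c
  have hcv : ⟪c, v⟫_ℝ = ⟪v, c⟫_ℝ := real_inner_comm v c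
  have hUW : ⟪‖c‖ ^ 2 • u - ⟪u, c⟫_ℝ • c, ‖c‖ ^ 2 • v - ⟪v, c⟫_ℝ • c⟫_ℝ =
      (‖c‖ ^ 2) ^ 2 * ⟪u, v⟫_ℝ - ‖c‖ ^ 2 * ⟪u, c⟫_ℝ * ⟪v, c⟫_ℝ := by
    simp only [inner_sub_left, inner_sub_right, real_inner_smul_left, real_inner_smul_right, hcc, hcv]
    ring
  have hUU : ‖‖c‖ ^ 2 • u - ⟪u, c⟫_ℝ • c‖ ^ 2 = ‖c‖ ^ 2 * (‖c‖ ^ 2 - ⟪u, c⟫_ℝ ^ 2) := by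
    rw [← real_inner_self_eq_norm_sq]
    simp only [inner_sub_left, inner_sub_right, real_inner_smul_left, real_inner_smul_right, hcc, hcu, huu]
    ring
  have hWW : ‖‖c‖ ^ 2 • v - ⟪v, c⟫_ℝ • c‖ ^ 2 = ‖c‖ ^ 2 * (‖c‖ ^ 2 - ⟪v, c⟫_ℝ ^ 2) := by
    rw [← real_inner_self_eq_norm_sq]
    simp only [inner_sub_left, inner_sub_right, real_inner_smul_left, real_inner_smul_right, hcc, hcv, hvv]
    ring
  have hCS : -(‖‖c‖ ^ 2 • u - ⟪u, c⟫_ℝ • c‖ * ‖‖c‖ ^ 2 • v - ⟪v, c⟫_ℝ • c‖) ≤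
      ⟪‖c‖ ^ 2 • u - ⟪u, c⟫_ℝ • c, ‖c‖ ^ 2 • v - ⟪v, c⟫_ℝ • c⟫_ℝ := by
    have h := abs_real_inner_le_norm (‖c‖ ^ 2 • u - ⟪u, c⟫_ℝ • c) (‖c‖ ^ 2 • v - ⟪v, c⟫_ℝ • c)
    rw [abs_le] at h
    exact h.1
  exact smallCap_arith hg hcap huc hvc (pow_le_pow_left₀ (hg.le.trans huc) hpc 2)
    (pow_le_pow_left₀ (hg.le.trans hvc) hqc 2) hUU hWW (norm_nonneg _) (norm_nonneg _) hCS hUW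

/-- **(L1), chord form.**  Two unit vectors in a cap of angular radius `< 30°` are at chord distance `< 1`. -/
theorem norm_sub_lt_one_of_mem_smallCap {u v c : V} {g : ℝ} (hu : ‖u‖ = 1) (hv : ‖v‖ = 1) (hg : 0 < g)
    (hcap : 3 * ‖c‖ ^ 2 < 4 * g ^ 2) (huc : g ≤ ⟪u, c⟫_ℝ) (hvc : g ≤ ⟪v, c⟫_ℝ) : ‖u - v‖ < 1 :=
  (norm_sub_lt_one_iff hu hv).2 (inner_gt_half_of_mem_smallCap hu hv hg hcap huc hvc)

/-- **(L1), capacity form.**  In a family `S` of unit vectors that are pairwise at chord distance `≥ 1`, at most one member lies in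
a cap `{x : g ≤ ⟪x, c⟫}` with `0 < g`, `3‖c‖² < 4g²`. -/
theorem smallCap_subsingleton {S : Set V} {c : V} {g : ℝ} (hS1 : ∀ u ∈ S, ‖u‖ = 1)
    (hsep : S.Pairwise fun u v => 1 ≤ ‖u - v‖) (hg : 0 < g) (hcap : 3 * ‖c‖ ^ 2 < 4 * g ^ 2) :
    {u ∈ S | g ≤ ⟪u, c⟫_ℝ}.Subsingleton := by
  intro u hu v hv
  by_contra hne
  have h1 := hsep hu.1 hv.1 hne
  have h2 := norm_sub_lt_one_of_mem_smallCap (hS1 u hu.1) (hS1 v hv.1) hg hcap hu.2 hv.2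
  linarith

/-- **(L1), counting form.**  For a finite family `T` of unit vectors pairwise at chord distance `≥ 1`, the members lying in a cap of
angular radius `< 30°` number at most one. -/
theorem card_filter_smallCap_le_one {T : Finset V} {c : V} {g : ℝ} (hT1 : ∀ u ∈ T, ‖u‖ = 1)
    (hsep : (T : Set V).Pairwise fun u v => 1 ≤ ‖u - v‖) (hg : 0 < g) (hcap : 3 * ‖c‖ ^ 2 < 4 * g ^ 2)
    [DecidablePred fun u : V => g ≤ ⟪u, c⟫_ℝ] :
    (T.filter fun u => g ≤ ⟪u, c⟫_ℝ).card ≤ 1 := by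
  rw [Finset.card_le_one]
  intro u hu v hv
  rw [Finset.mem_filter] at hu hv
  exact smallCap_subsingleton hT1 hsep hg hcap ⟨hu.1, hu.2⟩ ⟨hv.1, hv.2⟩

/-! ### (L2) Cell-in-cap: corner tests pass to the whole cell -/

section Cell

variable {ι : Type*}

/-- An affine lower bound at the corners passes to every convex combination: `m ≤ ⟪p_i, c⟫` for all `i` gives
`m ≤ ⟪∑ w_i p_i, c⟫`. -/
theorem le_inner_sum_smul {s : Finset ι} {w : ι → ℝ} {p : ι → V} {c : V} {m : ℝ}
    (hw0 : ∀ i ∈ s, 0 ≤ w i) (hw1 : ∑ i ∈ s, w i = 1) (hm : ∀ i ∈ s, m ≤ ⟪p i, c⟫_ℝ) :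
    m ≤ ⟪∑ i ∈ s, w i • p i, c⟫_ℝ := by
  rw [sum_inner]
  simp_rw [real_inner_smul_left]
  calc m = ∑ i ∈ s, w i * m := by rw [← Finset.sum_mul, hw1, one_mul]
    _ ≤ ∑ i ∈ s, w i * ⟪p i, c⟫_ℝ :=
        Finset.sum_le_sum fun i hi => mul_le_mul_of_nonneg_left (hm i hi) (hw0 i hi)

/-- A strict affine lower bound at the corners passes to every convex combination. -/
theorem lt_inner_sum_smul {s : Finset ι} {w : ι → ℝ} {p : ι → V} {c : V} {m : ℝ}
    (hw0 : ∀ i ∈ s, 0 ≤ w i) (hw1 : ∑ i ∈ s, w i = 1) (hm : ∀ i ∈ s, m < ⟪p i, c⟫_ℝ) :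
    m < ⟪∑ i ∈ s, w i • p i, c⟫_ℝ := by
  have hs : ∃ i ∈ s, 0 < w i := by
    by_contra h
    push Not at h
    have : ∑ i ∈ s, w i ≤ 0 := Finset.sum_nonpos h
    linarith
  obtain ⟨i₀, hi₀, hwi₀⟩ := hs
  rw [sum_inner]
  simp_rw [real_inner_smul_left]
  calc m = ∑ i ∈ s, w i * m := by rw [← Finset.sum_mul, hw1, one_mul]
    _ < ∑ i ∈ s, w i * ⟪p i, c⟫_ℝ :=
        Finset.sum_lt_sum (fun i hi => mul_le_mul_of_nonneg_left (hm i hi).le (hw0 i hi))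
          ⟨i₀, hi₀, mul_lt_mul_of_pos_left (hm i₀ hi₀) hwi₀⟩

/-- A norm bound at the corners passes to every convex combination (the norm is convex). -/
theorem norm_sum_smul_le {s : Finset ι} {w : ι → ℝ} {p : ι → V} {R : ℝ}
    (hw0 : ∀ i ∈ s, 0 ≤ w i) (hw1 : ∑ i ∈ s, w i = 1) (hR : ∀ i ∈ s, ‖p i‖ ≤ R) :
    ‖∑ i ∈ s, w i • p i‖ ≤ R := by
  calc ‖∑ i ∈ s, w i • p i‖ ≤ ∑ i ∈ s, ‖w i • p i‖ := norm_sum_le _ _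
    _ = ∑ i ∈ s, w i * ‖p i‖ :=
        Finset.sum_congr rfl fun i hi => by rw [norm_smul, Real.norm_of_nonneg (hw0 i hi)]
    _ ≤ ∑ i ∈ s, w i * R := Finset.sum_le_sum fun i hi => mul_le_mul_of_nonneg_left (hR i hi) (hw0 i hi)
    _ = R := by rw [← Finset.sum_mul, hw1, one_mul]

/-- Squared version (the checker bounds `max ‖p_i‖²`, a rational): `‖p_i‖² ≤ M` for all corners gives `‖∑ w_i p_i‖² ≤ M`. -/
theorem norm_sq_sum_smul_le {s : Finset ι} {w : ι → ℝ} {p : ι → V} {M : ℝ}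
    (hw0 : ∀ i ∈ s, 0 ≤ w i) (hw1 : ∑ i ∈ s, w i = 1) (hM : ∀ i ∈ s, ‖p i‖ ^ 2 ≤ M) :
    ‖∑ i ∈ s, w i • p i‖ ^ 2 ≤ M := by
  have hs : s.Nonempty := by
    rw [Finset.nonempty_iff_ne_empty]
    rintro rfl
    rw [Finset.sum_empty] at hw1
    exact zero_ne_one hw1
  obtain ⟨i₀, hi₀⟩ := hs
  have hM0 : 0 ≤ M := (sq_nonneg _).trans (hM i₀ hi₀)
  have hR : ∀ i ∈ s, ‖p i‖ ≤ Real.sqrt M := fun i hi =>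
    (Real.le_sqrt (norm_nonneg _) hM0).2 (hM i hi)
  have h := norm_sum_smul_le hw0 hw1 hR
  calc ‖∑ i ∈ s, w i • p i‖ ^ 2 ≤ Real.sqrt M ^ 2 := pow_le_pow_left₀ (norm_nonneg _) h 2
    _ = M := Real.sq_sqrt hM0

/-- **The squared rational test, closed form** (any sign of `g`): `0 < m ≤ ⟪v, c⟫`, `‖v‖² ≤ M` and `g²·M ≤ m²` give `g‖v‖ ≤ ⟪v, c⟫`.
(For `g ≤ 0` the left side is `≤ 0 < m`; for `g > 0`, `(g‖v‖)² ≤ g²M ≤ m²`.) -/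
theorem mul_norm_le_inner_of_sq_test {v c : V} {m M g : ℝ} (hm0 : 0 < m) (hm : m ≤ ⟪v, c⟫_ℝ)
    (hM : ‖v‖ ^ 2 ≤ M) (htest : g ^ 2 * M ≤ m ^ 2) : g * ‖v‖ ≤ ⟪v, c⟫_ℝ := by
  rcases le_or_gt g 0 with hg | hg
  · have h : g * ‖v‖ ≤ 0 := mul_nonpos_of_nonpos_of_nonneg hg (norm_nonneg v)
    linarith
  · have h1 : (g * ‖v‖) ^ 2 ≤ m ^ 2 := by
      rw [mul_pow]
      exact (mul_le_mul_of_nonneg_left hM (sq_nonneg g)).trans htest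
    exact ((sq_le_sq₀ (by positivity) hm0.le).1 h1).trans hm

/-- **The squared rational test, strict form** (any sign of `g`): `0 < m ≤ ⟪v, c⟫`, `‖v‖² ≤ M` and `g²·M < m²` give `g‖v‖ < ⟪v, c⟫`. -/
theorem mul_norm_lt_inner_of_sq_test {v c : V} {m M g : ℝ} (hm0 : 0 < m) (hm : m ≤ ⟪v, c⟫_ℝ)
    (hM : ‖v‖ ^ 2 ≤ M) (htest : g ^ 2 * M < m ^ 2) : g * ‖v‖ < ⟪v, c⟫_ℝ := by
  rcases le_or_gt g 0 with hg | hg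
  · have h : g * ‖v‖ ≤ 0 := mul_nonpos_of_nonpos_of_nonneg hg (norm_nonneg v)
    linarith
  · have h1 : (g * ‖v‖) ^ 2 < m ^ 2 := by
      rw [mul_pow]
      exact (mul_le_mul_of_nonneg_left hM (sq_nonneg g)).trans_lt htest
    exact ((sq_lt_sq₀ (by positivity) hm0.le).1 h1).trans_le hm

/-- **(L2) cell-in-cap, closed caps** (`capcc.cell_in_cap(corners, c, g, strict = False)`).  A cell is the set of directions of the
convex combinations `v = ∑ w_i p_i` of its corner vectors.  If `m := min ⟪p_i, c⟫ > 0` and `m² ≥ g²·max ‖p_i‖²` — here: some `m, M`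
with `0 < m ≤ ⟪p_i, c⟫`, `‖p_i‖² ≤ M`, `g²M ≤ m²` — then every such `v` is nonzero and `g‖v‖ ≤ ⟪v, c⟫`, i.e. its direction lies in
the closed cap `{x : g ≤ ⟪x, c⟫}` (`le_inner_normalize_of_cellInCap`). -/
theorem cellInCap_le {s : Finset ι} {w : ι → ℝ} {p : ι → V} {c : V} {m M g : ℝ}
    (hw0 : ∀ i ∈ s, 0 ≤ w i) (hw1 : ∑ i ∈ s, w i = 1) (hm0 : 0 < m) (hm : ∀ i ∈ s, m ≤ ⟪p i, c⟫_ℝ)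
    (hM : ∀ i ∈ s, ‖p i‖ ^ 2 ≤ M) (htest : g ^ 2 * M ≤ m ^ 2) :
    (∑ i ∈ s, w i • p i) ≠ 0 ∧ g * ‖∑ i ∈ s, w i • p i‖ ≤ ⟪∑ i ∈ s, w i • p i, c⟫_ℝ := by
  have h1 : m ≤ ⟪∑ i ∈ s, w i • p i, c⟫_ℝ := le_inner_sum_smul hw0 hw1 hm
  exact ⟨ne_zero_of_inner_pos (hm0.trans_le h1),
    mul_norm_le_inner_of_sq_test hm0 h1 (norm_sq_sum_smul_le hw0 hw1 hM) htest⟩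

/-- **(L2) cell-in-cap, open caps** (`capcc.cell_in_cap(corners, c, g, strict = True)`, used for blocker caps `{⟪x, w⟫ > ‖w‖²/2}` and
pin caps): with `g²M < m²` the conclusion is strict, `g‖v‖ < ⟪v, c⟫`. -/
theorem cellInCap_lt {s : Finset ι} {w : ι → ℝ} {p : ι → V} {c : V} {m M g : ℝ}
    (hw0 : ∀ i ∈ s, 0 ≤ w i) (hw1 : ∑ i ∈ s, w i = 1) (hm0 : 0 < m) (hm : ∀ i ∈ s, m ≤ ⟪p i, c⟫_ℝ)
    (hM : ∀ i ∈ s, ‖p i‖ ^ 2 ≤ M) (htest : g ^ 2 * M < m ^ 2) :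
    (∑ i ∈ s, w i • p i) ≠ 0 ∧ g * ‖∑ i ∈ s, w i • p i‖ < ⟪∑ i ∈ s, w i • p i, c⟫_ℝ := by
  have h1 : m ≤ ⟪∑ i ∈ s, w i • p i, c⟫_ℝ := le_inner_sum_smul hw0 hw1 hm
  exact ⟨ne_zero_of_inner_pos (hm0.trans_le h1),
    mul_norm_lt_inner_of_sq_test hm0 h1 (norm_sq_sum_smul_le hw0 hw1 hM) htest⟩

/-- Normalised reading of `g‖v‖ ≤ ⟪v, c⟫` for `v ≠ 0`: the direction `‖v‖⁻¹ • v` lies in the closed cap `{x : g ≤ ⟪x, c⟫}`. -/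
theorem le_inner_normalize {v c : V} {g : ℝ} (hv : v ≠ 0) (h : g * ‖v‖ ≤ ⟪v, c⟫_ℝ) :
    g ≤ ⟪‖v‖⁻¹ • v, c⟫_ℝ := by
  rw [real_inner_smul_left, le_inv_mul_iff₀ (norm_pos_iff.2 hv)]
  linarith

/-- Normalised reading of `g‖v‖ < ⟪v, c⟫` for `v ≠ 0`: the direction `‖v‖⁻¹ • v` lies in the open cap `{x : g < ⟪x, c⟫}`. -/
theorem lt_inner_normalize {v c : V} {g : ℝ} (hv : v ≠ 0) (h : g * ‖v‖ < ⟪v, c⟫_ℝ) :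
    g < ⟪‖v‖⁻¹ • v, c⟫_ℝ := by
  rw [real_inner_smul_left, lt_inv_mul_iff₀ (norm_pos_iff.2 hv)]
  linarith

/-- **(L2), normalised closed form**: under the closed corner test every direction of the cell lies in `{x : g ≤ ⟪x, c⟫}`. -/
theorem le_inner_normalize_of_cellInCap {s : Finset ι} {w : ι → ℝ} {p : ι → V} {c : V} {m M g : ℝ}
    (hw0 : ∀ i ∈ s, 0 ≤ w i) (hw1 : ∑ i ∈ s, w i = 1) (hm0 : 0 < m) (hm : ∀ i ∈ s, m ≤ ⟪p i, c⟫_ℝ)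
    (hM : ∀ i ∈ s, ‖p i‖ ^ 2 ≤ M) (htest : g ^ 2 * M ≤ m ^ 2) :
    g ≤ ⟪‖∑ i ∈ s, w i • p i‖⁻¹ • ∑ i ∈ s, w i • p i, c⟫_ℝ := by
  obtain ⟨hv, h⟩ := cellInCap_le hw0 hw1 hm0 hm hM htest
  exact le_inner_normalize hv h

/-- **(L2), normalised open form**: under the strict corner test every direction of the cell lies in `{x : g < ⟪x, c⟫}`. -/
theorem lt_inner_normalize_of_cellInCap {s : Finset ι} {w : ι → ℝ} {p : ι → V} {c : V} {m M g : ℝ}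
    (hw0 : ∀ i ∈ s, 0 ≤ w i) (hw1 : ∑ i ∈ s, w i = 1) (hm0 : 0 < m) (hm : ∀ i ∈ s, m ≤ ⟪p i, c⟫_ℝ)
    (hM : ∀ i ∈ s, ‖p i‖ ^ 2 ≤ M) (htest : g ^ 2 * M < m ^ 2) :
    g < ⟪‖∑ i ∈ s, w i • p i‖⁻¹ • ∑ i ∈ s, w i • p i, c⟫_ℝ := by
  obtain ⟨hv, h⟩ := cellInCap_lt hw0 hw1 hm0 hm hM htest
  exact lt_inner_normalize hv h

end Cell


end CapChecker

end Summit.Ventures.Crystal3D.Theorems
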